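import Summits.BirchSwinnertonDyer.BirchSwinnertonDyer.Theorems.QuadraticBranchSignedControlPlusEtaBottomLayerTrivial
import Summits.BirchSwinnertonDyer.BirchSwinnertonDyer.Theorems.QuadraticBranchSignedControlPlusEtaCMRankZeroOfUpper
import HarnessLib

/-!
# Route `QuadraticBranchSignedControl` (rung K8, cell `bsd-potss`), residual crux
# `PlusEtaMainConjectureNonsurj` (stmt-BirchSwinnertonDyer-19606): the KATO-FREE UNIT-ROW ROAD —
# Kobayashi's even main conjecture at `η` for `(V,p)` HOLDS on every row whose additive partner `W`
# has `Sel_{p^∞}(W/ℚ) = 0`, `p ∤ Tam(W)` and `v_p(L(W,1)/Ω_W) ≤ 0`, with NO hypothesis on the image of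
# `ρ_{V,p}` and NO Euler-system input; on the CM rows the per-row input is two integers of Cremona's
# table (`p ∤ #Ш(W)_an`, `p ∤ Tam(W)`) granted Burungale–Flach (seat `bsd-potss-k8eta-c2` g2)

WHAT. Crux 19606 is Kobayashi's (C1⁺_η) — `X⁺(V/K_∞)^η` f.g. torsion and `Char = (L_p⁺(V,η,X))` — on
the good supersingular `a_p = 0` twists `V` (`p ≥ 5`) whose `p`-adic tower is NOT onto (CM ∪ image
`C_ns⁺(p)`), where Thm. 4.1 gives only `pⁿ`. By the companion files (`…PlusEtaBottomLayerFinite/Trivial`,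
this seat) the bottom layer kills the Iwasawa module outright on the UNIT rows: for the additive partner
`W` (`C • W^{(p*)} = V`), `Sel_{p^∞}(W/ℚ) = 0 ∧ p ∤ Tam(W) ⟹ X⁺_W(ℚ_∞) = 0`, and by ctrl g4's
(D5⁺)⁻¹ (`exists_strictSignedSelmerDualData_one_of_eta`) `X⁺_W(ℚ_∞)` IS `X⁺(V/K_∞)^η`. So on these rows
(C1⁺_η)(V) says EXACTLY `L_p⁺(V,η,X) ∈ Λˣ`, i.e. `v_p(L_p⁺(V,η,0)) = 0`, i.e. — by the cell's value
identity `v_p(L_p⁺(V,η,0)) = v_p(L(W,1)/Ω_W)` (`valuation_constantCoeff_eq_padicValRat_of_twist`) —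
`v_p(L(W,1)/Ω_W) ≤ 0`: ONE rational number per row, or the lower half of `BSD_p(W)` in Miller's
currency (`v_p(L(W,1)/Ω_W) ≤ ord_p #Sel + ord_p(Tam/#tors²) = 0`).

* §1 `selmerGroupPInfty_eq_bot_of_finite_of_padicValNat_card_sha` — rank `0` and `p ∤ #Ш(W)` ⟹
  `Sel_{p^∞}(W/ℚ) = 0` (`#Sel_{p^∞} = #Ш[p^∞]`).
* §2 **`quadraticBranchPlusEtaMainConjectureAt_of_selmer_trivial`** (core; modularity `hmod` the only
  named fact): `Sel_{p^∞}(W/ℚ) = 0`, `p ∤ Tam(W)`, `L(W,1) ≠ 0`, `v_p(L(W,1)/Ω_W) ≤ 0` ⟹ (C1⁺_η)(V);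
  `…_of_selmer_trivial_of_missingLowerBoundAt` (Miller's currency, + GZK);
  **`…_of_bsdp_of_shaAn_unit`** (`BSD(W,p)` + `v_p(#Ш(W)_an) ≤ 0` + `p ∤ Tam(W)`, + GZK);
  **`…_of_hasCM_of_shaAn_unit`** (CM rows: `BSD(W,p)` is Burungale–Flach bsd.S28 — per row only
  `v_p(#Ш(W)_an) ≤ 0` and `p ∤ Tam(W)`; named facts `hmod`, `hGZK`, `hS28` ONLY).
* §3 the stub-shaped ∀-forms on 19606's binders: `etaMC_cm_unitRows` (CM), `etaMC_nonsurj_unitRows_of_bsdp`.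
NO Poitou–Tate, NO Kobayashi Thm. 2.2 / 4.1, NO Kitajima–Otsuki, NO `μ`, NO image hypothesis enter.

HONEST FRAMING (cell `bsd-potss`, run/shared/lean/pub/bsd-potss/; FULL-BSD rank ≤ 1 programme,
tranche 1b, HUMAN RULING D-0036/D-0074): BOOKKEEPING THEOREMS ONLY — no definition, no named
Literature fact minted, no Summits-side `def … : Prop`, no `sorry`, axioms standard. CONDITIONAL on
modularity (`hasEntireLFunction_rat`), GZK (`rank_eq_analyticRank_of_analyticRank_le_one`) and, on the
CM rows, Burungale–Flach 2024 (`bsdTriple_of_hasCM_of_L_one_ne_zero`, bsd.S28) — named facts,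
hypothesis position — and on DISPLAYED per-row inputs (`Sel_{p^∞}(W/ℚ) = 0` resp. `BSD(W,p)`,
`v_p(#Ш(W)_an) ≤ 0`, `p ∤ Tam(W)`). These are the UNIT rows — by construction OUTSIDE the cell's
residue table (whose rows have `p ∣ #Ш_an·Tam`); the class-wide crux 19606 stays OPEN; no stub is
proved by name; nothing is booked; no label / mark / count moves; `BSD(W,p)` is an INPUT (or bsd.S28),
claimed for no new pair. `--supports stmt-BirchSwinnertonDyer-19606`.

References: [Kobayashi2003] §4 Even main conjecture (p. 8), (3.6) (p. 7), Thm. 9.3 with (9.33)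
(pp. 26–27); [GreenbergLNM1716] §3 Prop. 3.8 (pp. 95–96), §4 Thm. 4.1; [Kurihara2002] Thm. 0.1 (the
unit case on the trivial component; shape only); [BurungaleFlach2024] Thm. 1.1 + Cor. 2;
[Miller2011LMS] §1, Def. 1.1; [MazurTateTeitelbaum1986Invent] §I.8 (8.6); [Washington1997] §7.1.
-/

set_option autoImplicit false
set_option linter.dupNamespace false

noncomputable section

open scoped Classical

open CongruenceSubgroup Field Function NumberField IsDedekindDomain WeierstrassCurve
open Literature.NumberTheory.EllipticCurves
open Literature.NumberTheory.EllipticCurves.ModularForms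
open Literature.NumberTheory.EllipticCurves.Rank1Residual
open Literature.NumberTheory.EllipticCurves.Rank1Residual.Typed
open Literature.NumberTheory.GaloisRepresentations
open Literature.NumberTheory.GaloisCohomology
open Literature.NumberTheory.EllipticCurves.IwasawaAlgebra
open Literature.NumberTheory.EllipticCurves.IwasawaDual ZpExtension
open Summit.BirchSwinnertonDyer.Rank1Residual.X11b.Levels
open Summit.BirchSwinnertonDyer.Rank1Residual.X11b
open Summit.BirchSwinnertonDyer.Rank1Residual.Additive
open Summit.BirchSwinnertonDyer.Rank1Residual.Additive.SignedTwist
open scoped ContRepresentation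
open Summit.BirchSwinnertonDyer.Rank1Residual.AdditivePotMult

namespace Summit.BirchSwinnertonDyer.BirchSwinnertonDyer.Theorems

namespace EtaUnitRows

/-! ## §1 Rank `0` and `p ∤ #Ш(W)` ⟹ `Sel_{p^∞}(W/ℚ) = 0` -/

section Selmer

variable (W : WeierstrassCurve ℚ) [W.IsElliptic] (p : ℕ) [hp : Fact p.Prime]

/-- **`W(ℚ)` finite and `p ∤ #Ш(W)` ⟹ `Sel_{p^∞}(W/ℚ) = 0`**: `#Sel_{p^∞}(W/ℚ) = #Ш(W)[p^∞]`
(`natCard_selmerGroupPInfty_eq_natCard_primaryComponent_sha`, rank `0`) `= p^{ord_p #Ш(W)} = 1`.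
[cite: GreenbergLNM1716, §1 p. 54 and §4 p. 103] [cite: SilvermanAEC2009, X.4 (definition of Sel and Ш)] -/
theorem selmerGroupPInfty_eq_bot_of_finite_of_padicValNat_card_sha [Finite W.toAffine.Point]
    [Finite W.sha] (hsha : padicValNat p (Nat.card W.sha) = 0) : W.selmerGroupPInfty p = ⊥ := by
  apply AddSubgroup.eq_bot_of_card_eq
  rw [W.natCard_selmerGroupPInfty_eq_natCard_primaryComponent_sha p, card_addPrimaryComponent_eq_pow,
    Nat.factorization_def _ hp.out, hsha, pow_zero]

end Selmer

/-! ## §2 The unit-row road at `η` -/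

section Road

variable (W : WeierstrassCurve ℚ) [W.IsElliptic] [W.IsGloballyMinimal] (p : ℕ) [hp : Fact p.Prime]

/-- **THE KATO-FREE UNIT-ROW ROAD (core form).** `W` globally minimal, `p ≥ 5`, `V` a globally
minimal model of `W^{(p*)}` (`C • W.quadraticTwist ((−1)^{p/2} p) = V`) good at `p` with `a_p(V) = 0`;
per row: `Sel_{p^∞}(W/ℚ) = 0`, `p ∤ Tam(W)`, `L(W,1) ≠ 0` and `v_p(L(W,1)/Ω_W) ≤ 0` (for the rational
number `L(W,1)/Ω_W`); named fact: modularity (`hmod`). CONCLUSION: Kobayashi's even main conjecture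
at `η` for `(V,p)` in full (`QuadraticBranchPlusEtaMainConjectureAt V p`). PROOF: for an `η`-datum `D'`
over an abstract `K₀ = ℚ(μ_p)` (`θ² = p*`, `ηq` = the sign character of `θ`), (D5⁺)⁻¹ gives a plus
dual datum `D` of `W` over `ℚ_∞` with the same module; `X⁺_W = 0`
(`EtaBottomLayer.subsingleton_X_of_selmer_trivial_of_not_dvd_tamagawa`: `A₀⁺ = 0 ⟹ (Sel⁺_∞)^γ = 0 ⟹
Sel⁺_∞ = 0`), so `X` is f.g. torsion with `Char = Λ`; and `Λ = (Lη)` because `v_p(Lη(0)) =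
v_p(L(W,1)/Ω_W) ≤ 0` (value identity) makes `Lη(0) ∈ ℤ_p^×`. NO Kato / Thm. 4.1, NO image hypothesis,
NO Thm. 2.2, NO Kitajima–Otsuki, NO Poitou–Tate. CONDITIONAL on the displayed per-row inputs; nothing
booked. [cite: Kobayashi2003, §4 Even main conjecture (p. 8), (3.6) (p. 7), Thm. 9.3 with (9.33) (pp. 26–27)]
[cite: GreenbergLNM1716, §3 Prop. 3.8 (pp. 95–96)] [cite: MazurTateTeitelbaum1986Invent, §I.8 (8.6)]
[cite: Washington1997, §7.1] -/
theorem quadraticBranchPlusEtaMainConjectureAt_of_selmer_trivial (hmod : hasEntireLFunction_rat)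
    (V : WeierstrassCurve ℚ) [V.IsElliptic] [V.IsGloballyMinimal] (C : VariableChange ℚ)
    (hp5 : 5 ≤ p) (hCV : C • W.quadraticTwist ((-1) ^ (p / 2) * p) = V)
    (hgood : V.HasGoodReductionAtPrime p) (hap : V.frobeniusTrace p = 0)
    (hSel : W.selmerGroupPInfty p = ⊥) (hTam : ¬ p ∣ W.tamagawaProduct)
    (hLW : W.entireLFunction 1 ≠ 0)
    (hle : ∀ q : ℚ, W.entireLFunction 1 / (W.realPeriodRat : ℂ) = (q : ℂ) → padicValRat p q ≤ 0) :
    QuadraticBranchPlusEtaMainConjectureAt V p := by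
  intro K₀ _ _ _ _ ηq hηK hη1 N _ f hp2 hgoodV hapV hf ϖ hϖ Lη hL κ γ hκ hγ hγK hγc D'
  -- the dictionary data at the abstract `K₀ = ℚ(μ_p)`: `θ² = p*`, `ηq` = the sign character of `θ`
  obtain ⟨θ, hθ2⟩ := exists_sq_eq_pStar p K₀ hp2
  have hc : θ ^ 2 = algebraMap ℚ K₀ ((-1) ^ (p / 2) * p) := by
    rw [hθ2, map_mul, map_pow, map_neg, map_one, map_natCast]
  have hθ : θ ∉ Set.range (algebraMap ℚ K₀) := by
    rintro ⟨q, hq⟩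
    apply forall_sq_ne_pStar p q
    apply (algebraMap ℚ K₀).injective
    rw [map_pow, hq, hc]
  have hη := eta_eq_one_iff_smul_rootInClosure p K₀ hθ hc ηq hηK hη1
  have hDloc := localTowerHyp_padic p κ K₀ hκ
  have hκ₀ := kappa_surjOn_galRange_cyclotomic κ K₀
  have hcop := coprime_index_galRange_cyclotomic p K₀
  -- (D5⁺)⁻¹: the plus dual datum of `W` over `ℚ_∞` with the SAME module
  obtain ⟨D, hfin, htor, hchar, -⟩ :=
    ConverseControl.exists_strictSignedSelmerDualData_one_of_eta W K₀ hθ hc p κ hCV ηq hη ℚ_[p] hDloc hκ₀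
      hcop hγK D'
  -- `X⁺_W(ℚ_∞) = 0`
  haveI : Subsingleton D.X :=
    EtaBottomLayer.subsingleton_X_of_selmer_trivial_of_not_dvd_tamagawa κ W hp5 hκ C V hCV hgood hap hγ
      hSel hTam D
  have htop : D'.charIdeal = ⊤ := hchar ▸ EtaBottomLayer.charIdeal_eq_top_of_subsingleton D
  refine ⟨hfin.mp (EtaBottomLayer.moduleFinite_of_subsingleton D),
    htor.mp (EtaBottomLayer.isTorsion_of_subsingleton D), ?_⟩
  -- `Lη ∈ Λˣ`: `v_p(Lη(0)) = v_p(L(W,1)/Ω_W) ≤ 0`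
  obtain ⟨q, hq⟩ :=
    EvenControlZero.exists_rat_entireLFunction_one_div_of_twist W p hmod hp2 V C hCV hgood hf hϖ
  obtain ⟨hval, h0L⟩ :=
    valuation_constantCoeff_eq_padicValRat_of_twist p hmod hp2 W V C hCV hgood hf hϖ hL hq
  have hL0 : PowerSeries.constantCoeff Lη ≠ 0 := h0L hLW
  have h1 : Ideal.span {(1 : IwasawaAlgebra p)} = Ideal.span {Lη} := by
    refine span_singleton_eq_of_dvd_of_valuation_le (one_dvd Lη) hL0 ?_
    rw [hval, map_one, PadicInt.coe_one, Padic.valuation_one]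
    exact hle q hq
  rw [htop, ← h1, Ideal.span_singleton_one]

/-- **The unit-row road in Miller's currency.** As `quadraticBranchPlusEtaMainConjectureAt_of_selmer_trivial`
with `v_p(L(W,1)/Ω_W) ≤ 0` supplied by the lower half of `BSD_p(W)` (`Typed.MissingLowerBoundAt W p`,
`ord_p #Ш(W)_an ≤ ord_p #Ш(W)`) through ctrl g4's reverse bookkeeping
`padicValRat_le_selmer_of_missingLowerBoundAt_rankZero` (`≤ ord_p #Sel + ord_p(Tam/#tors²) = 0`:
`Sel = 0`, `p ∤ Tam(W)`, `p ∤ #W(ℚ)_tors` for the twist). Named facts: modularity, GZK.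
[cite: Miller2011LMS, §1 and Def. 1.1] [cite: Kobayashi2003, §4 (p. 8), Thm. 9.3 (p. 26)] -/
theorem quadraticBranchPlusEtaMainConjectureAt_of_selmer_trivial_of_missingLowerBoundAt
    (hmod : hasEntireLFunction_rat) (hGZK : rank_eq_analyticRank_of_analyticRank_le_one)
    (V : WeierstrassCurve ℚ) [V.IsElliptic] [V.IsGloballyMinimal] (C : VariableChange ℚ)
    (hp5 : 5 ≤ p) (hCV : C • W.quadraticTwist ((-1) ^ (p / 2) * p) = V)
    (hgood : V.HasGoodReductionAtPrime p) (hap : V.frobeniusTrace p = 0)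
    (hSel : W.selmerGroupPInfty p = ⊥) (hTam : ¬ p ∣ W.tamagawaProduct)
    (hLW : W.entireLFunction 1 ≠ 0) (hlow : MissingLowerBoundAt W p) :
    QuadraticBranchPlusEtaMainConjectureAt V p := by
  have hp2 : p ≠ 2 := by omega
  refine quadraticBranchPlusEtaMainConjectureAt_of_selmer_trivial W p hmod V C hp5 hCV hgood hap hSel hTam
    hLW fun q hq ↦ ?_
  have h := ConverseControl.padicValRat_le_selmer_of_missingLowerBoundAt_rankZero W p hGZK hLW hq hlow
  -- `ord_p #Sel = 0`, `ord_p Tam(W) = 0`, `ord_p #W(ℚ)_tors = 0`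
  have hSel1 : Nat.card ↥(W.selmerGroupPInfty p) = 1 := by rw [hSel]; exact AddSubgroup.card_bot
  have htors := eq_zero_of_prime_smul_eq_zero_padic_of_quadraticTwist_goodSupersingular hp2 W C V hCV hgood hap
  have htors0 := LevelBridge.padicValNat_torsionOrder_eq_zero_of_noPTorsion W p htors
  have hTamQ : (W.tamagawaProduct : ℚ) ≠ 0 := by exact_mod_cast W.tamagawaProduct_pos_holds.ne'
  have htQ : (W.torsionOrder : ℚ) ≠ 0 := by exact_mod_cast W.torsionOrder_pos_holds.ne'
  have hrat : padicValRat p ((W.tamagawaProduct : ℚ) / (W.torsionOrder : ℚ) ^ 2) = 0 := by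
    rw [padicValRat.div hTamQ (pow_ne_zero 2 htQ), padicValRat.pow, padicValRat.of_nat, padicValRat.of_nat,
      htors0, padicValNat.eq_zero_of_not_dvd hTam]
    simp
  rw [hSel1, padicValNat_one_right, hrat] at h
  simpa using h

/-- **The unit-row road from `BSD(W,p)`.** If Miller's `BSD(W,p)` holds (INPUT — e.g. bsd.S28 on the CM
rows, or a per-pair exact descent), `L(W,1) ≠ 0`, `v_p(#Ш(W)_an) ≤ 0` and `p ∤ Tam(W)`, then (C1⁺_η)(V):
`BSD(W,p)` gives `ord_p #Ш(W)[p^∞] = v_p(#Ш_an) ≤ 0`, so with rank `0` (GZK) `Sel_{p^∞}(W/ℚ) = 0`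
(§1), and `BSD(W,p) ⊇` the lower half; the previous theorem concludes. Named facts: modularity, GZK.
[cite: Miller2011LMS, §1 and Def. 1.1] [cite: Kobayashi2003, §4 (p. 8)] -/
theorem quadraticBranchPlusEtaMainConjectureAt_of_bsdp_of_shaAn_unit
    (hmod : hasEntireLFunction_rat) (hGZK : rank_eq_analyticRank_of_analyticRank_le_one)
    (V : WeierstrassCurve ℚ) [V.IsElliptic] [V.IsGloballyMinimal] (C : VariableChange ℚ)
    (hp5 : 5 ≤ p) (hCV : C • W.quadraticTwist ((-1) ^ (p / 2) * p) = V)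
    (hgood : V.HasGoodReductionAtPrime p) (hap : V.frobeniusTrace p = 0)
    (hbsd : BSDp W p) (hLW : W.entireLFunction 1 ≠ 0)
    (hsha : ∃ s : ℚ, shaAn W = (s : ℂ) ∧ padicValRat p s ≤ 0) (hTam : ¬ p ∣ W.tamagawaProduct) :
    QuadraticBranchPlusEtaMainConjectureAt V p := by
  -- rank `0`, `W(ℚ)` and `Ш(W)` finite (GZK)
  have hr0 : W.analyticRank = 0 := analyticRank_eq_zero_of_entireLFunction_one_ne_zero W hLW
  obtain ⟨hrank, hfin⟩ := hGZK W (by rw [hr0]; exact zero_le_one)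
  haveI : Finite W.sha := hfin
  haveI : Finite W.toAffine.Point := W.finite_point_of_rank_zero (by rw [hrank, hr0])
  -- `BSD(W,p)`: `ord_p #Ш[p^∞] = v_p(#Ш_an) ≤ 0`
  obtain ⟨-, -, q, hq, hvq⟩ := hbsd
  obtain ⟨s, hs, hvs⟩ := hsha
  have hqs : q = s := by exact_mod_cast hq.symm.trans hs
  have hsha0 : padicValNat p (Nat.card W.sha) = 0 := by
    rw [← padicValNat_card_addPrimaryComponent (A := W.sha) p]
    have h : (padicValNat p (Nat.card (AddCommGroup.primaryComponent W.sha p)) : ℤ) ≤ 0 := by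
      rw [← hvq, hqs]; exact hvs
    omega
  have hSel := selmerGroupPInfty_eq_bot_of_finite_of_padicValNat_card_sha W p hsha0
  have hlow : MissingLowerBoundAt W p :=
    (lower_and_upper_of_missingPPartAt W p (missingPPartAt_of_bsdp W p ⟨by rw [hrank], inferInstance,
      q, hq, hvq⟩)).1
  exact quadraticBranchPlusEtaMainConjectureAt_of_selmer_trivial_of_missingLowerBoundAt W p hmod hGZK V C
    hp5 hCV hgood hap hSel hTam hLW hlow

/-- **THE CM UNIT ROWS: (C1⁺_η)(V) from two integers of Cremona's table.** `V` CM, `p ≥ 5`, good with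
`a_p(V) = 0` (so `p` inert in the CM field and the tower is never onto), `C • W^{(p*)} = V` with `W`
globally minimal, `L(W,1) ≠ 0`, `v_p(#Ш(W)_an) ≤ 0`, `p ∤ Tam(W)`: then Kobayashi's even main
conjecture at `η` holds for `(V,p)`. `W` is CM (`j(W) = j(V)`), so the FULL BSD formula for `W` is
Burungale–Flach's bsd.S28 (`bsdTriple_of_hasCM_of_L_one_ne_zero`), whence `BSD(W,p)` and the previous
theorem. Named facts: modularity, GZK, bsd.S28 — NOTHING from Iwasawa theory (no Kato, no Thm. 2.2 /
4.1, no Kitajima–Otsuki, no Poitou–Tate, no `μ`), no image hypothesis. Per row: `#Ш(W)_an` and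
`Tam(W)`. CONDITIONAL; nothing booked; `BSD(W,p)` is bsd.S28 here, claimed for no new pair.
[cite: BurungaleFlach2024, Thm 1.1 and Cor. 2] [cite: PollackRubin2004, Theorem and remark p. 448]
[cite: Kobayashi2003, §4 Even main conjecture (p. 8)] [cite: SilvermanAEC2009, III.1.4(b)] -/
theorem quadraticBranchPlusEtaMainConjectureAt_of_hasCM_of_shaAn_unit
    (hmod : hasEntireLFunction_rat) (hGZK : rank_eq_analyticRank_of_analyticRank_le_one)
    (hS28 : bsdTriple_of_hasCM_of_L_one_ne_zero)
    (V : WeierstrassCurve ℚ) [V.IsElliptic] [V.IsGloballyMinimal] (C : VariableChange ℚ)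
    (hp5 : 5 ≤ p) (hCV : C • W.quadraticTwist ((-1) ^ (p / 2) * p) = V)
    (hgood : V.HasGoodReductionAtPrime p) (hap : V.frobeniusTrace p = 0) (hCM : V.HasCM)
    (hLW : W.entireLFunction 1 ≠ 0)
    (hsha : ∃ s : ℚ, shaAn W = (s : ℂ) ∧ padicValRat p s ≤ 0) (hTam : ¬ p ∣ W.tamagawaProduct) :
    QuadraticBranchPlusEtaMainConjectureAt V p := by
  have hd : ((-1 : ℚ) ^ (p / 2) * p) ≠ 0 :=
    mul_ne_zero (pow_ne_zero _ (neg_ne_zero.mpr one_ne_zero)) (Nat.cast_ne_zero.mpr hp.out.ne_zero)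
  haveI := W.isElliptic_quadraticTwist hd
  -- `W` is CM: `j(V) = j(W^{(p*)}) = j(W)`
  have hj : V.j = W.j := by subst hCV; rw [variableChange_j, j_quadraticTwist W hd]
  have hCMW : W.HasCM := (hasCM_iff_of_j_eq hj).mp hCM
  -- bsd.S28: the full BSD formula for the CM curve `W` of analytic rank `0`
  have hT : W.BSDTriple := hS28 W hCMW hLW
  exact quadraticBranchPlusEtaMainConjectureAt_of_bsdp_of_shaAn_unit W p hmod hGZK V C hp5 hCV hgood hap
    (forall_bsdp_of_bsdTriple' W hT p hp.out) hLW hsha hTam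

end Road

/-! ## §3 The stub-shaped ∀-forms on 19606's binders -/

/-- **19606 on its CM UNIT rows — no Iwasawa-theoretic input at all.** On the binders of `stub_etaMC_cm`
(`p ≥ 5`, `V` good with `a_p = 0`, tower NOT onto — displayed, idle — `V` CM) with the partner `W`
(`C • W^{(p*)} = V`, globally minimal, `L(W,1) ≠ 0`) and the two per-row integers `v_p(#Ш(W)_an) ≤ 0`,
`p ∤ Tam(W)`: the crux's conclusion `QuadraticBranchPlusEtaMainConjectureAt V p`, granted modularity,
GZK and Burungale–Flach's bsd.S28 (named facts). CONDITIONAL; `stub_etaMC_cm` is not proved by name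
(its rows with `p ∣ #Ш(W)_an·Tam(W)` and its rank-`1` rows are not touched); nothing booked.
[cite: BurungaleFlach2024, Thm 1.1 and Cor. 2] [cite: Kobayashi2003, §4 Even main conjecture (p. 8)]
[cite: PollackRubin2004, Theorem and remark p. 448] -/
theorem etaMC_cm_unitRows (hmod : hasEntireLFunction_rat)
    (hGZK : rank_eq_analyticRank_of_analyticRank_le_one) (hS28 : bsdTriple_of_hasCM_of_L_one_ne_zero) :
    ∀ (V : WeierstrassCurve ℚ) [V.IsElliptic] [V.IsGloballyMinimal] (p : ℕ) [Fact p.Prime],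
      5 ≤ p → V.HasGoodReductionAtPrime p → V.frobeniusTrace p = 0 →
      ¬ (∀ m : ℕ, V.HasSurjectiveModNGaloisRep (p ^ m : ℕ)) → V.HasCM →
      ∀ (W : WeierstrassCurve ℚ) [W.IsElliptic] [W.IsGloballyMinimal] (C : VariableChange ℚ),
        C • W.quadraticTwist ((-1) ^ (p / 2) * p) = V → W.entireLFunction 1 ≠ 0 →
        (∃ s : ℚ, shaAn W = (s : ℂ) ∧ padicValRat p s ≤ 0) → ¬ p ∣ W.tamagawaProduct →
        QuadraticBranchPlusEtaMainConjectureAt V p := by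
  intro V _ _ p _ hp5 hgood hap _ hCM W _ _ C hCV hLW hsha hTam
  exact quadraticBranchPlusEtaMainConjectureAt_of_hasCM_of_shaAn_unit W p hmod hGZK hS28 V C hp5 hCV hgood
    hap hCM hLW hsha hTam

/-- **19606 on ANY unit row, `BSD(W,p)` currency.** On the crux's binders (`p ≥ 5`, `V` good with
`a_p = 0`, tower NOT onto — displayed, idle) with the partner `W` (`C • W^{(p*)} = V`, globally
minimal, `L(W,1) ≠ 0`), Miller's `BSD(W,p)` (INPUT), `v_p(#Ш(W)_an) ≤ 0` and `p ∤ Tam(W)`: the crux's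
conclusion at `(V,p)`, granted modularity and GZK. CM or not, no image condition, no Iwasawa-theoretic
named fact. CONDITIONAL; no stub proved by name; nothing booked.
[cite: Miller2011LMS, §1 and Def. 1.1] [cite: Kobayashi2003, §4 Even main conjecture (p. 8)]
[cite: GreenbergLNM1716, §3 Prop. 3.8 (pp. 95–96)] -/
theorem etaMC_nonsurj_unitRows_of_bsdp (hmod : hasEntireLFunction_rat)
    (hGZK : rank_eq_analyticRank_of_analyticRank_le_one) :
    ∀ (V : WeierstrassCurve ℚ) [V.IsElliptic] [V.IsGloballyMinimal] (p : ℕ) [Fact p.Prime],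
      5 ≤ p → V.HasGoodReductionAtPrime p → V.frobeniusTrace p = 0 →
      ¬ (∀ m : ℕ, V.HasSurjectiveModNGaloisRep (p ^ m : ℕ)) →
      ∀ (W : WeierstrassCurve ℚ) [W.IsElliptic] [W.IsGloballyMinimal] (C : VariableChange ℚ),
        C • W.quadraticTwist ((-1) ^ (p / 2) * p) = V → W.entireLFunction 1 ≠ 0 → BSDp W p →
        (∃ s : ℚ, shaAn W = (s : ℂ) ∧ padicValRat p s ≤ 0) → ¬ p ∣ W.tamagawaProduct →
        QuadraticBranchPlusEtaMainConjectureAt V p := by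
  intro V _ _ p _ hp5 hgood hap _ W _ _ C hCV hLW hbsd hsha hTam
  exact quadraticBranchPlusEtaMainConjectureAt_of_bsdp_of_shaAn_unit W p hmod hGZK V C hp5 hCV hgood hap
    hbsd hLW hsha hTam

end EtaUnitRows

end Summit.BirchSwinnertonDyer.BirchSwinnertonDyer.Theorems

end
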